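import Mathlib
import HarnessLib
import Summits.HubbardSuperconductivity.HubbardSuperconductivity.Theorems.KLProgrammeKLRegimeSplitEdgeFactsBubbleTransferModulus

/-!
# Route `KLProgramme` — edge facts for the pair masses ACROSS TRANSFERS, IX: the REGION ASSEMBLY of the transfer modulus — row 16's double sum localised to the
# support regions of the member, with pointwise jet bounds and region counts as the only inputs (the (D2)-deep row BY SHAPE)

Cell gate-hubbard-kl, seat hubbard-kl-k3c1-p1 (g21; child-1 lineage; technique: composed-map remainder propagation).  Row 16
(`abs_sum_klTransferWeight_sub_pin_le`) bounds `|Σ_p t_n[φ](Q,p) − Σ_p t_n[φ](0,p)|` by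
`½(βL²)⁻¹·Σ_νΣ_p (‖g^w_ν(p)‖·‖δ²_Q g^φ_ν(p)‖ + ‖g^φ_ν(p)‖·‖δ²_Q g^w_ν(p)‖)`, `g^e = e·ĝ_K`, `w = w^K_{Λ_n}`.  The first summand vanishes unless one of
`p, p ± Q` meets the support of `φ(ν,·)` (the THREE-POINT REGION `T`), the second unless `(ν,p) ∈ supp φ =: S`.  THIS FILE performs exactly that localisation:

* §1 `klta_sum_le_card_mul`: a sum of a function vanishing off `T` and `≤ B` on `T` is `≤ #T·B`; `klta_sum_sum_eq_sum_prod` (iterated sum = sum over pairs);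
  `klta_norm_ofReal_mul` (`‖(x : ℂ)·z‖ = |x|·‖z‖`);
* §2 **`klta_abs_sum_klTransferWeight_sub_pin_le_of_regions`**: given the hard line `|w|·‖ĝ‖ ≤ h` everywhere, the three-point region `T` of `φ` at step `Q`
  with the pointwise bound `‖δ²_Q(φĝ)(ν,p)‖ ≤ D` on `T`, and the support `S` of `φ` with the soft line `|φ|·‖ĝ‖ ≤ h′` and `‖δ²_Q(wĝ)(ν,p)‖ ≤ D′` on `S`:
  **`|Σ_p t_n[φ](Q,p) − Σ_p t_n[φ](0,p)| ≤ ½(βL²)⁻¹·(h·D·#T + h′·D′·#S)`**.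

Reading for (D2)-deep: `h = 2/Λ_n` (`…TransferLines.hubbardCutoffWeightCT_mul_norm_propCT_le`), `D, D′ = C·|p_Q|_𝕋²` from rows 21/22 (`…RungJets`, `…RungJetsTransport`, on
the transition layers; the flat parts contribute `δ²_Q ĝ` only, row 21 §1), `#T ≤ 3·#{ω² + e_K² ≤ r}` and `#S ≤ #{ω² + e_K² ≤ r} ≲ r·βL²` (row 23 `…SoftCount`), so the
`βL²` CANCELS and `|W_n(Q) − W_n(0)| ≲ (|p_Q|_𝕋/Λ)²` at the member's scales — E1 chooses `T, S, h′, D, D′` per member.  Everything is proved; no definitions; nothing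
asserts any slot, stub, K3 or SC. [folklore]
-/

noncomputable section

namespace Summit.HubbardSuperconductivity.HubbardSuperconductivity.Theorems.KLRegimeSplit

set_option linter.dupNamespace false -- summit = problem name (single-conjunct summit), D-0017

open Real Finset Literature.MathematicalPhysics.QuantumLattice Literature.Probability.LatticeModels
open Literature.MathematicalPhysics.QuantumLattice.FermiRG
open Summit.HubbardSuperconductivity.HubbardSuperconductivity.Theorems.KLProgrammeLegKernels
open Summit.HubbardSuperconductivity.HubbardSuperconductivity.Theorems.TwoPointAssembly

/-! ## §1 Localised sums -/

/-- **A localised sum**: `P` vanishes off `T` and is `≤ B` on `T` ⟹ `Σ_i P i ≤ #T·B`. [folklore] -/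
theorem klta_sum_le_card_mul {ι : Type*} [Fintype ι] [DecidableEq ι] (P : ι → ℝ) (T : Finset ι) (B : ℝ) (hzero : ∀ i ∉ T, P i = 0)
    (hle : ∀ i ∈ T, P i ≤ B) : ∑ i, P i ≤ T.card * B := by
  rw [← Finset.sum_subset (Finset.subset_univ T) fun i _ hi => hzero i hi]
  have h := Finset.sum_le_card_nsmul T P B hle
  rwa [nsmul_eq_mul] at h

/-- The iterated frequency–momentum sum is the sum over `FreqMomentum L M`. [folklore] -/
theorem klta_sum_sum_eq_sum_prod {L M : ℕ} [NeZero L] (X : MatsubaraIdx M → TorusSite 2 L → ℝ) :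
    ∑ ν : MatsubaraIdx M, ∑ p : TorusSite 2 L, X ν p = ∑ k : FreqMomentum L M, X k.1 k.2 :=
  (Fintype.sum_prod_type' X).symm

/-- `‖(x : ℂ)·z‖ = |x|·‖z‖`. [folklore] -/
theorem klta_norm_ofReal_mul (x : ℝ) (z : ℂ) : ‖(x : ℂ) * z‖ = |x| * ‖z‖ := by
  rw [norm_mul, Complex.norm_real, Real.norm_eq_abs]

/-! ## §2 The region assembly of the transfer modulus -/

section Regions

variable {L M : ℕ} [NeZero L] (β μ : ℝ) (K : TrigPolyC4v)

/-- **The transfer modulus of an even member, localised** (`0 < β`; `φ` even in frequency and momentum; `w = w^K_{Λ_n}`): with the hard line `|w(k)|·‖ĝ_K(k)‖ ≤ h`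
for all `k`, a region `T` off which `φ(ν,p+Q) = φ(ν,p) = φ(ν,p−Q) = 0` and on which `‖δ²_Q(φĝ)(ν,p)‖ ≤ D`, and a region `S` off which `φ = 0` and on which
`|φ(k)|·‖ĝ_K(k)‖ ≤ h′`, `‖δ²_Q(wĝ)(ν,p)‖ ≤ D′` (`h, h′ ≥ 0`):
`|Σ_p t_n[φ](Q,p) − Σ_p t_n[φ](0,p)| ≤ ½(βL²)⁻¹·(h·D·#T + h′·D′·#S)`. [folklore] -/
theorem klta_abs_sum_klTransferWeight_sub_pin_le_of_regions (hβ : 0 < β) (n : ℕ) {φ : FreqMomentum L M → ℝ}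
    (hφ : ∀ k : FreqMomentum L M, φ (k.1.rev, k.2) = φ k) (hφ' : ∀ k : FreqMomentum L M, φ (k.1, -k.2) = φ k) (Qm : TorusSite 2 L)
    (T S : Finset (FreqMomentum L M)) {h D h' D' : ℝ} (hh0 : 0 ≤ h) (hh0' : 0 ≤ h')
    (hhard : ∀ k : FreqMomentum L M, |hubbardCutoffWeightCT L M β μ K (klScale klE0 n) k| * ‖propCT L M β μ K k‖ ≤ h)
    (hT : ∀ (ν : MatsubaraIdx M) (p : TorusSite 2 L), (ν, p) ∉ T → φ (ν, p + Qm) = 0 ∧ φ (ν, p) = 0 ∧ φ (ν, p - Qm) = 0)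
    (hD : ∀ (ν : MatsubaraIdx M) (p : TorusSite 2 L), (ν, p) ∈ T →
      ‖(φ (ν, p + Qm) : ℂ) * propCT L M β μ K (ν, p + Qm) - 2 * ((φ (ν, p) : ℂ) * propCT L M β μ K (ν, p)) +
        (φ (ν, p - Qm) : ℂ) * propCT L M β μ K (ν, p - Qm)‖ ≤ D)
    (hS : ∀ k : FreqMomentum L M, k ∉ S → φ k = 0)
    (hsoft : ∀ k : FreqMomentum L M, k ∈ S → |φ k| * ‖propCT L M β μ K k‖ ≤ h')
    (hD' : ∀ (ν : MatsubaraIdx M) (p : TorusSite 2 L), (ν, p) ∈ S →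
      ‖(hubbardCutoffWeightCT L M β μ K (klScale klE0 n) (ν, p + Qm) : ℂ) * propCT L M β μ K (ν, p + Qm) -
          2 * ((hubbardCutoffWeightCT L M β μ K (klScale klE0 n) (ν, p) : ℂ) * propCT L M β μ K (ν, p)) +
        (hubbardCutoffWeightCT L M β μ K (klScale klE0 n) (ν, p - Qm) : ℂ) * propCT L M β μ K (ν, p - Qm)‖ ≤ D') :
    |∑ p, klTransferWeight L M β μ K n φ Qm p - ∑ p, klTransferWeight L M β μ K n φ 0 p| ≤
      1 / 2 * (β * (L : ℝ) ^ 2)⁻¹ * (h * D * T.card + h' * D' * S.card) := by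
  classical
  set w := hubbardCutoffWeightCT L M β μ K (klScale klE0 n) with hw
  set G := propCT L M β μ K with hG
  -- the two localised summands
  set P₁ : FreqMomentum L M → ℝ := fun k =>
    ‖(w k : ℂ) * G k‖ * ‖(φ (k.1, k.2 + Qm) : ℂ) * G (k.1, k.2 + Qm) - 2 * ((φ (k.1, k.2) : ℂ) * G (k.1, k.2)) +
      (φ (k.1, k.2 - Qm) : ℂ) * G (k.1, k.2 - Qm)‖ with hP₁
  set P₂ : FreqMomentum L M → ℝ := fun k =>
    ‖(φ k : ℂ) * G k‖ * ‖(w (k.1, k.2 + Qm) : ℂ) * G (k.1, k.2 + Qm) - 2 * ((w (k.1, k.2) : ℂ) * G (k.1, k.2)) +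
      (w (k.1, k.2 - Qm) : ℂ) * G (k.1, k.2 - Qm)‖ with hP₂
  have h1 : ∑ k, P₁ k ≤ T.card * (h * D) := by
    refine klta_sum_le_card_mul P₁ T (h * D) (fun k hk => ?_) (fun k hk => ?_)
    · obtain ⟨a, b, c⟩ := hT k.1 k.2 (by simpa using hk)
      simp only [hP₁, a, b, c, Complex.ofReal_zero, zero_mul, mul_zero, sub_zero, add_zero, norm_zero]
    · have hk' : (k.1, k.2) ∈ T := by simpa using hk
      simp only [hP₁]
      rw [klta_norm_ofReal_mul]
      exact mul_le_mul (hhard k) (hD k.1 k.2 hk') (norm_nonneg _) hh0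
  have h2 : ∑ k, P₂ k ≤ S.card * (h' * D') := by
    refine klta_sum_le_card_mul P₂ S (h' * D') (fun k hk => ?_) (fun k hk => ?_)
    · simp only [hP₂, hS k hk, Complex.ofReal_zero, zero_mul, norm_zero]
    · have hk' : (k.1, k.2) ∈ S := by simpa using hk
      simp only [hP₂]
      rw [klta_norm_ofReal_mul]
      exact mul_le_mul (hsoft k hk) (hD' k.1 k.2 hk') (norm_nonneg _) hh0'
  have hmain := abs_sum_klTransferWeight_sub_pin_le β μ K hβ.le n hφ hφ' Qm
  have hsplit : ∑ ν : MatsubaraIdx M, ∑ p : TorusSite 2 L,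
      (‖(w (ν, p) : ℂ) * G (ν, p)‖ * ‖(φ (ν, p + Qm) : ℂ) * G (ν, p + Qm) - 2 * ((φ (ν, p) : ℂ) * G (ν, p)) + (φ (ν, p - Qm) : ℂ) * G (ν, p - Qm)‖ +
        ‖(φ (ν, p) : ℂ) * G (ν, p)‖ * ‖(w (ν, p + Qm) : ℂ) * G (ν, p + Qm) - 2 * ((w (ν, p) : ℂ) * G (ν, p)) + (w (ν, p - Qm) : ℂ) * G (ν, p - Qm)‖) =
      ∑ k, P₁ k + ∑ k, P₂ k := by
    rw [← sum_add_distrib, klta_sum_sum_eq_sum_prod]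
  have hc : 0 ≤ 1 / 2 * (β * (L : ℝ) ^ 2)⁻¹ := by positivity
  refine hmain.trans ?_
  rw [hsplit]
  refine mul_le_mul_of_nonneg_left ?_ hc
  linarith

end Regions

end Summit.HubbardSuperconductivity.HubbardSuperconductivity.Theorems.KLRegimeSplit

end
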